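import Summits.QuantumFields.YangMills.Theorems.BalabanUVNodesSpineReadingOfRecord13CoPHKComponentSizeBlocksFreshProduct
import Literature.Probability.LatticeModels.PolymerGasPinnedPresence

/-!
# THE N20 PRODUCT SOCKET IN POLYMER CURRENCY AND ITS PRINT-SHAPED SCHEDULE: (§1) an AGE-GEOMETRIC fresh-letter profile `ζ K j i = e^{−q K j}·σ K j^{lv K j − lv K i}·τ K j^{j−i}` (creation
# factor × survival factors per block level and per level of age, `L^4·σ ≤ 1`, `τ ≤ ½`) meets the inheritance-volume numerics of gen 35's joint-fresh face UNIFORMLY in the level, from ONE inequality of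
# [LF-II] p.389's kind, `4c(ϱ)²·e^{−q} ≤ 1`, giving `W K = 2^{−(K+1)}`; (§2) the joint-fresh PRODUCT letters themselves follow from a NON-NEGATIVE HARD-CORE POLYMER DOMINATION of
# the (2.18) class weights on the sequence index (R3b of `T4WeightBudgetKP` ∕ the `PosDom` shape of `T4PeierlsDomination`, in JOINT form, made concrete for this socket) by
# Peierls' bound in polymer language — positivity only, NO Kotecký–Preiss

Cell `pub-ymgap`, YM-PLAN Track A (HUMAN RULING D-0062; width push D-0149); seat `pub-ymgap-dag-n20-d` (R134 (a) N20 NE7b s3 = the U5d ∕ `crOfRecord₁₃` lineage, its declarer)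
gen 36; companion of `…CoPHKComponentSizeBlocksFreshProduct` (gen 35: ★★★ `relWeightBound_card_of_jointFreshSeqLetters_id_supNear`, hypotheses `hPA ∕ hPB`, numerics `hζ0 ∕ hζη ∕
hη0 ∕ hη1 ∕ hη₀ ∕ hD`) and of `Literature.Probability.LatticeModels.PolymerGasPinnedPresence` (gen 36: `sum_prod_le_sum_prod_mul_re_polymerPartitionFunction_of_cover`).
`--kind proof --supports stmt-QuantumFields-27366 --as helper` (K3⁸); COUNT-NEUTRAL; THEOREMS ONLY (0 `def`).  [III] = [Balaban1988Convergent]; [LF-II] = [Balaban1989LargeFieldII];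
[F–V] = [FriedliVelenik2017].
WHY.  (§1) The row's numerics «`W_K < 1`, `Σ_K W_K < ∞` from [LF-II] (1.79)–(1.89) pp. 383–387» end to end at the sharpest socket of record: print pays ONE factor per NEW
large-field region — (1.79) p. 383 «we estimate the factors by exp(−p₀(g_j))», (1.85) p. 386 — and a SURVIVAL cost per further step a component stays pending — (1.80) p. 384
`κ_j(Z) ≥ Σ_{n=j+1}^{j+K} O(1)M^dR_n^{d+1}d′_n(S^{n−j}(Z))`, banked along (1.83)–(1.88) —, under p. 389's working inequality «−¼p₀(g_k) + 1 + 2κ(100R_k)^d ≤ 0».  The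
profile `ζ K j i = e^{−q K j}·σ K j^{lv K j − lv K i}·τ K j^{j−i}` is that shape; with `L^4·σ ≤ 1`, `τ ≤ ½` («survival beats the volume entropy per coarsening»,
`T4WeightBudget.survivalRate_pos_iff`'s «p₀∕N > 4 log L») its inheritance volume is `≤ 2e^{−q}` for EVERY `j` (★ `sum_volume_ageProfile_le`, geometric in the age), so gen 35's six numerical hypotheses
collapse to ONE per `(K, j)` — `4·((2ϱ+1)^4·81·(2ϱ+1)^4)²·e^{−q K j} ≤ 1`, «`q ≥ 2 log c(ϱ) + log 4`» — and the face holds with `W K = 2^{−(K+1)}` (★★★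
`relWeightBound_card_of_ageJointFreshSeqLetters_id_supNear`).  LOCATED on the way (gen 35's prose «levels the record no longer carries contribute ζ = 0»): at the IDENTITY key
reading a «live-window» profile with weight ZERO below the window is NOT inhabitable — an old fresh cause still pending at the top is a non-empty event of positive weight
(it is NE7b's own bad event) —; the print-shaped substitute is age-geometric decay.  (§2) For the PRODUCT socket the term-to-total normalisation (R3 of `T4WeightBudgetKP`) costs nothing beyond
positivity: in a hard-core polymer gas with NON-NEGATIVE activities the families containing a pinned family `C` weigh `≤ (Π_{γ∈C} x γ)·Ξ(Λ)` (gen 36 `…PolymerGasPinnedPresence`,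
F–V Lemma 3.37's monotonicity step — the JOINT form next to `T4PeierlsDomination` §1's KP-free UNION form `pinnedGas_Z_union_le` ∕ `PosDom`).  Hence a NON-NEGATIVE HARD-CORE
POLYMER DOMINATION of one
run's (2.18) class weights at fixed `(K, t)` — a gas `(inc, x ≥ 0, Λ)`, `c ≥ 0` with `c·Ξ(Λ) ≤ Σ_s classWeightOfDatum₉ … s`, and per separated family and fresh assignment `a` a
finite event `E` dominating the fresh event's class weights (`≤ c·` gas weight of `E`), covered by pins `𝒞` with `Σ_{C∈𝒞} Π_C x ≤ Π_b ζ K j i_b` — yields gen 35's `hPA ∕ hPB`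
VERBATIM (★★ `jointFreshSeqLetters_A∕B_of_polymerDom`), and the face follows (★★★ `relWeightBound_card_of_polymerDom_id_supNear`, ★★★ `…_of_agePolymerDom_…`).  [LF-II]
prints towards the domination the per-step SIGNED expansion (1.90)–(1.92) p. 388; the history-indexed, positive, multi-step domination is R3b — NOT PRINTED, nobody's theorem —
here displayed in the exact shape this socket consumes.
HONEST FRAMING.  [folklore] finite-sum bookkeeping BY NAME + elementary real inequalities; the age-geometric letters and the polymer dominations are HYPOTHESES (inhabited for no family
today; NOT PRINTED as statements about the (2.18) class weights); NO weight is bounded, NO estimate proved; nothing of Bałaban's asserted; NE7 ∕ NE7b ∕ NE7c NOT PRINTED for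
`d = 4` ∕ NOT proved; no `Provisos₁₃CoPH` inhabitant claimed (K0⁷ OPEN); K3⁸ v7 untouched; N19 ∕ N20 ∕ N21 ∕ N27 NOT discharged; counts UNMOVED (typed 28∕28 · discharged 8∕27); one
finite four-torus programme at fixed `ε` — NOT ℝ⁴, NOT OS, NOT a mass gap, NOT Clay.  No `def`, no `instance`, no `notation`, no `sorry`; no decl below carries a cite tag.
-/

noncomputable section

open Finset

namespace YMDAG.UVSplit

open Literature.MathematicalPhysics.QuantumFieldTheory.Balaban1983to89
open Literature.MathematicalPhysics.QuantumFieldTheory.Balaban1983to89.T4Continuum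
open Literature.MathematicalPhysics.QuantumFieldTheory.Balaban1983to89.Node00
open Literature.MathematicalPhysics.QuantumFieldTheory.Balaban1983to89.B5Eq118OneStroke (iterBlockOf iterBlock)
open _root_.Literature.Probability.LatticeModels (IsCompatible polymerPartitionFunction sum_prod_le_sum_prod_mul_re_polymerPartitionFunction_of_cover)
open T4WeightBudget (RelWeightBound)

variable {F : T4Family} {N : ℕ} [NeZero N]

/-! ## §1 The print-shaped schedule: an AGE-GEOMETRIC fresh-letter profile meets the inheritance-volume numerics uniformly in the level -/

section Schedule

variable (lv : ℕ → ℕ → ℕ)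

/-- `Σ_{i ∈ [1, j]} (½)^{j − i} ≤ 2` (distinct exponents, geometric series). [bookkeeping] -/
theorem sum_Icc_half_pow_sub_le (j : ℕ) : ∑ i ∈ Finset.Icc 1 j, (1 / 2 : ℝ) ^ (j - i) ≤ 2 := by
  have hinj : Set.InjOn (fun i => j - i) ↑(Finset.Icc 1 j) := by
    intro a ha b hb h
    have ha' := Finset.mem_Icc.1 (Finset.mem_coe.1 ha)
    have hb' := Finset.mem_Icc.1 (Finset.mem_coe.1 hb)
    have h' : j - a = j - b := h
    omega
  rw [← Finset.sum_image (f := fun n => (1 / 2 : ℝ) ^ n) hinj]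
  exact (summable_geometric_two.sum_le_tsum _ (fun n _ => by positivity)).trans tsum_geometric_two.le

/-- ★ **THE INHERITANCE VOLUME OF THE AGE-GEOMETRIC PROFILE, UNIFORMLY IN THE LEVEL**: for a survival factor `0 ≤ σ` per block level with `L^4·σ ≤ 1` («survival cancels the
volume entropy `L^4` per coarsening», the shape of `T4WeightBudget.survivalRate_pos_iff`'s «p₀∕N > 4 log L») and a further factor `0 ≤ τ ≤ ½` per level of age, the profile
`ζ i = e^{−q}·σ^{lv K j − lv K i}·τ^{j − i}` has `Σ_{i ∈ [1,j]} (L^4)^{lv K j − lv K i}·ζ i ≤ 2·e^{−q}` for EVERY `j` (no monotonicity of `lv` needed). [bookkeeping] -/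
theorem sum_volume_ageProfile_le (K j : ℕ) {σ τ : ℝ} (hσ0 : 0 ≤ σ) (hσ : ((F.L : ℝ) ^ 4) * σ ≤ 1) (hτ0 : 0 ≤ τ) (hτ : τ ≤ 1 / 2) (q : ℝ) :
    ∑ i ∈ Finset.Icc 1 j, ((F.L ^ 4) ^ (lv K j - lv K i) : ℝ) * (Real.exp (-q) * σ ^ (lv K j - lv K i) * τ ^ (j - i)) ≤ 2 * Real.exp (-q) := by
  have hterm : ∀ i, ((F.L ^ 4) ^ (lv K j - lv K i) : ℝ) * (Real.exp (-q) * σ ^ (lv K j - lv K i) * τ ^ (j - i)) ≤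
      Real.exp (-q) * (1 / 2 : ℝ) ^ (j - i) := by
    intro i
    have h1 : ((F.L ^ 4 : ℕ) : ℝ) ^ (lv K j - lv K i) * σ ^ (lv K j - lv K i) ≤ 1 := by
      rw [← mul_pow]; exact pow_le_one₀ (by positivity) (by exact_mod_cast hσ)
    calc ((F.L ^ 4) ^ (lv K j - lv K i) : ℝ) * (Real.exp (-q) * σ ^ (lv K j - lv K i) * τ ^ (j - i))
        = Real.exp (-q) * ((((F.L ^ 4 : ℕ) : ℝ) ^ (lv K j - lv K i) * σ ^ (lv K j - lv K i)) * τ ^ (j - i)) := by push_cast; ring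
      _ ≤ Real.exp (-q) * (1 * (1 / 2 : ℝ) ^ (j - i)) :=
          mul_le_mul_of_nonneg_left (mul_le_mul h1 (pow_le_pow_left₀ hτ0 hτ _) (by positivity) zero_le_one) (Real.exp_pos _).le
      _ = Real.exp (-q) * (1 / 2 : ℝ) ^ (j - i) := by rw [one_mul]
  refine (Finset.sum_le_sum fun i _ => hterm i).trans ?_
  rw [← Finset.mul_sum, mul_comm]
  exact mul_le_mul_of_nonneg_right (sum_Icc_half_pow_sub_le j) (Real.exp_pos _).le

/-- **THE ONE PRINT-SHAPED INEQUALITY GIVES GEN 35's NUMERICS**: if `4·c(ϱ)²·e^{−q} ≤ 1` with `c(ϱ) = (2ϱ+1)^4·81·(2ϱ+1)^4 ≥ 1`, then `η := 2e^{−q}` has `0 ≤ η ≤ 1` and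
`2·c(ϱ)²·η ≤ 1` — «`q ≥ 2 log c(ϱ) + log 4`», [LF-II] p. 389's kind of condition on `p₀(g_k)`. [bookkeeping] -/
theorem ageProfile_numerics (q : ℝ) (ϱ : ℕ)
    (h : 2 * ((((2 * ϱ + 1) ^ 4 : ℕ) : ℝ) * 3 ^ 4 * ((2 * ϱ + 1) ^ 4 : ℕ)) ^ 2 * (2 * Real.exp (-q)) ≤ 1) :
    0 ≤ 2 * Real.exp (-q) ∧ 2 * Real.exp (-q) ≤ 1 := by
  refine ⟨by positivity, ?_⟩
  have h1 : (1 : ℝ) ≤ (((2 * ϱ + 1) ^ 4 : ℕ) : ℝ) := by exact_mod_cast Nat.one_le_pow _ _ (by omega)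
  have h2 : (1 : ℝ) ≤ (((2 * ϱ + 1) ^ 4 : ℕ) : ℝ) * 3 ^ 4 * ((2 * ϱ + 1) ^ 4 : ℕ) := by nlinarith
  have hc : (1 : ℝ) ≤ 2 * ((((2 * ϱ + 1) ^ 4 : ℕ) : ℝ) * 3 ^ 4 * ((2 * ϱ + 1) ^ 4 : ℕ)) ^ 2 := by nlinarith [one_le_pow₀ (n := 2) h2]
  have hη : 0 ≤ 2 * Real.exp (-q) := by positivity
  nlinarith

end Schedule
section AgeFace

variable (θ : Stage13HParams F N) (hP : θ.Provisos₁₃CoPH F N) (K₀ : ℕ) (g₀ : ℕ → ℝ) (os : List (ULoop F)) (jcut : ℕ → ℕ) (ϱ k lv : ℕ → ℕ → ℕ) (q σ τ : ℕ → ℕ → ℝ)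

open scoped Classical in
/-- ★★★ **THE N20 FACE FROM AGE-GEOMETRIC JOINT-FRESH PRODUCT LETTERS UNDER ONE PRINT-SHAPED INEQUALITY** (`0 < M`; block levels `lv K` monotone on `[1, jcut K]`, `lv K j ≤ j`,
in range; schedule `k K j ≥ ⌈log₂ |Site_{lv K j}|⌉ + K + j + 3`; survival factors `0 ≤ σ K j`, `L^4·σ K j ≤ 1` and `0 ≤ τ K j ≤ ½`; an exponent `q K j` with
`4·((2ϱ+1)^4·81·(2ϱ+1)^4)²·e^{−q K j} ≤ 1` on `[1, jcut K]`).  The letters are gen 35's `hPA ∕ hPB` with the profile `ζ K j i := e^{−q K j}·σ K j^{lv K j − lv K i}·τ K j^{j − i}` —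
a factor `e^{−q K j}` per block for the CREATION of its fresh cause ([LF-II] (1.79) p. 383) and `σ` per block level ∕ `τ` per level it stays pending up to the top ((1.80) p. 384 ∕
(1.88) p. 387, the banked survival cost) — NOT a «live window, weight zero below» profile, which is not inhabitable at the identity key reading (an old fresh cause pending at the top has positive
weight).  Conclusion: `RelWeightBound` at the identity-keyed component-size carriers with `W K := 2^{−(K+1)}` (gen 35's face, `η₀ = 1`, `η K j := 2e^{−q K j}` on `[1, jcut K]`). [bookkeeping] -/
theorem relWeightBound_card_of_ageJointFreshSeqLetters_id_supNear (hM : 0 < θ.τ9.M)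
    (hσ0 : ∀ K j, 0 ≤ σ K j) (hσ : ∀ K j, ((F.L : ℝ) ^ 4) * σ K j ≤ 1) (hτ0 : ∀ K j, 0 ≤ τ K j) (hτ : ∀ K j, τ K j ≤ 1 / 2)
    (hq : ∀ K, ∀ j ∈ Finset.Icc 1 (jcut K), 2 * ((((2 * ϱ K j + 1) ^ 4 : ℕ) : ℝ) * 3 ^ 4 * ((2 * ϱ K j + 1) ^ 4 : ℕ)) ^ 2 * (2 * Real.exp (-q K j)) ≤ 1)
    (hks : ∀ K j, Nat.clog 2 (Fintype.card (Site (F.P (K₀ + K)) (lv K j))) + K + j + 3 ≤ k K j) (hlv : ∀ K j, lv K j ≤ F.m + (K₀ + K))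
    (hlvj : ∀ K, ∀ j ∈ Finset.Icc 1 (jcut K), lv K j ≤ j) (hmono : ∀ K i i', 1 ≤ i → i ≤ i' → i' ≤ jcut K → lv K i ≤ lv K i')
    (hPA : ∀ (K : ℕ) (t : ℝ), |t| ≤ 1 → ∀ j ∈ Finset.Icc 1 (jcut K),
      ∀ p ∈ sepAnimalCoverFamily (SiteTouch (P := F.P (K₀ + K)) (j := lv K j)) (SupNear (P := F.P (K₀ + K)) (j := lv K j) (ϱ K j)) (k K j),
      ∀ a ∈ p.2.pi (fun b => (Finset.Icc 1 j).sigma fun i => Finset.univ.filter (fun c : Site (F.P (K₀ + K)) (lv K i) =>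
        (↑(iterBlock (lv K i) c) : Set (Site (F.P (K₀ + K)) 0)) ⊆ ↑(iterBlock (lv K j) b))),
      ∑ s ∈ Finset.univ.filter (fun s : SeqOfRecord F θ.ν θ.τ9.M (histA₁₃ θ K₀ g₀ K) (K₀ + K) (K₀ + K) =>
          ∀ x ∈ p.2.attach, (↑(iterBlock (lv K (a x.1 x.2).1) (a x.1 x.2).2) : Set (Site (F.P (K₀ + K)) 0)) ⊆ (s.Λ (a x.1 x.2).1)ᶜ ∧
            (2 ≤ (a x.1 x.2).1 → (↑(iterBlock (lv K (a x.1 x.2).1) (a x.1 x.2).2) : Set (Site (F.P (K₀ + K)) 0)) ⊆ s.Λ ((a x.1 x.2).1 - 1))),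
        classWeightOfDatum₉ F N θ.toStage9Params (datumOfRecord₁₃CoPH F N θ hP) g₀ os (runA₁₃ F K₀ g₀ K) (histA₁₃ θ K₀ g₀ K) (K₀ + K) t s ≤
      (∏ x ∈ p.2.attach, (Real.exp (-q K j) * σ K j ^ (lv K j - lv K (a x.1 x.2).1) * τ K j ^ (j - (a x.1 x.2).1))) *
        ∑ s : SeqOfRecord F θ.ν θ.τ9.M (histA₁₃ θ K₀ g₀ K) (K₀ + K) (K₀ + K),
          classWeightOfDatum₉ F N θ.toStage9Params (datumOfRecord₁₃CoPH F N θ hP) g₀ os (runA₁₃ F K₀ g₀ K) (histA₁₃ θ K₀ g₀ K) (K₀ + K) t s)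
    (hPB : ∀ (K : ℕ) (t : ℝ), |t| ≤ 1 → ∀ j ∈ Finset.Icc 1 (jcut K),
      ∀ p ∈ sepAnimalCoverFamily (SiteTouch (P := F.P (K₀ + K)) (j := lv K j)) (SupNear (P := F.P (K₀ + K)) (j := lv K j) (ϱ K j)) (k K j),
      ∀ a ∈ p.2.pi (fun b => (Finset.Icc 1 j).sigma fun i => Finset.univ.filter (fun c : Site (F.P (K₀ + K)) (lv K i) =>
        (↑(iterBlock (lv K i) c) : Set (Site (F.P (K₀ + K)) 0)) ⊆ ↑(iterBlock (lv K j) b))),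
      ∑ s' ∈ Finset.univ.filter (fun s' : SeqOfRecord F θ.ν θ.τ9.M (histB₁₃ θ K₀ g₀ K) (K₀ + K + 1) (K₀ + K + 1) =>
          ∀ x ∈ p.2.attach, (↑(iterBlock (lv K (a x.1 x.2).1) (a x.1 x.2).2) : Set (Site (F.P (K₀ + K)) 0)) ⊆
              ((truncShift F θ.ν hM (histB₁₃ θ K₀ g₀ K) s').Λ (a x.1 x.2).1)ᶜ ∧
            (2 ≤ (a x.1 x.2).1 → (↑(iterBlock (lv K (a x.1 x.2).1) (a x.1 x.2).2) : Set (Site (F.P (K₀ + K)) 0)) ⊆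
              (truncShift F θ.ν hM (histB₁₃ θ K₀ g₀ K) s').Λ ((a x.1 x.2).1 - 1))),
        classWeightOfDatum₉ F N θ.toStage9Params (datumOfRecord₁₃CoPH F N θ hP) g₀ os (runB₁₃ F K₀ g₀ K) (histB₁₃ θ K₀ g₀ K) (K₀ + K + 1) t s' ≤
      (∏ x ∈ p.2.attach, (Real.exp (-q K j) * σ K j ^ (lv K j - lv K (a x.1 x.2).1) * τ K j ^ (j - (a x.1 x.2).1))) *
        ∑ s' : SeqOfRecord F θ.ν θ.τ9.M (histB₁₃ θ K₀ g₀ K) (K₀ + K + 1) (K₀ + K + 1),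
          classWeightOfDatum₉ F N θ.toStage9Params (datumOfRecord₁₃CoPH F N θ hP) g₀ os (runB₁₃ F K₀ g₀ K) (histB₁₃ θ K₀ g₀ K) (K₀ + K + 1) t s') :
    RelWeightBound 1 (classSetK₁₃ θ K₀ g₀ (keyReadingId₁₃ N K₀ F θ hP g₀ os)) (weightAK₁₃ θ hP K₀ g₀ os (keyReadingId₁₃ N K₀ F θ hP g₀ os))
      (weightBK₁₃ θ hP K₀ g₀ os (keyReadingId₁₃ N K₀ F θ hP g₀ os))
      (badClassK₁₃ θ K₀ g₀ (keyReadingId₁₃ N K₀ F θ hP g₀ os)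
        (badKeyReadingOfBigComponent₁₃ N K₀ jcut (bigDialOfCard₁₃ K₀ (fun K j => (2 * ϱ K j + 1) ^ 4 * k K j * (F.L ^ 4) ^ lv K j)) F θ hP g₀ os))
      (fun K => (1 : ℝ) * (1 / 2) ^ (K + 1)) := by
  refine relWeightBound_card_of_jointFreshSeqLetters_id_supNear θ hP K₀ g₀ os jcut ϱ k lv hM
    (η := fun K j => if j ∈ Finset.Icc 1 (jcut K) then 2 * Real.exp (-q K j) else 0) (η₀ := 1)
    (fun K j => ?_) (fun K j => ?_) le_rfl (fun K j => ?_) hks hlv hlvj hmono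
    (ζ := fun K j i => Real.exp (-q K j) * σ K j ^ (lv K j - lv K i) * τ K j ^ (j - i))
    (fun K j _ => mul_nonneg (mul_nonneg (Real.exp_pos _).le (pow_nonneg (hσ0 K j) _)) (pow_nonneg (hτ0 K j) _))
    (fun K j hj => ?_) hPA hPB
  · split_ifs <;> positivity
  · split_ifs with hj
    · exact (ageProfile_numerics (q K j) (ϱ K j) (hq K j hj)).2
    · exact zero_le_one
  · split_ifs with hj
    · exact hq K j hj
    · rw [mul_zero]; exact zero_le_one
  · rw [if_pos hj]
    exact sum_volume_ageProfile_le lv K j (hσ0 K j) (hσ K j) (hτ0 K j) (hτ K j) (q K j)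

end AgeFace

/-! ## §2 The joint-fresh product letters from a non-negative hard-core polymer domination (R3b concrete; Peierls' bound in polymer language) -/

section Polymer

variable (θ : Stage13HParams F N) (hP : θ.Provisos₁₃CoPH F N) (K₀ : ℕ) (g₀ : ℕ → ℝ) (os : List (ULoop F)) (jcut : ℕ → ℕ) (ϱ k lv : ℕ → ℕ → ℕ)
  (ζ : ℕ → ℕ → ℕ → ℝ)

open scoped Classical in
/-- ★★ **RUN A — THE JOINT-FRESH PRODUCT LETTERS FROM A NON-NEGATIVE HARD-CORE POLYMER DOMINATION.**  Data (the supplier's): a polymer type `PolA` with symmetric decidable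
incompatibility `incA`, and per `(K, t)` non-negative activities `xA K t`, a finite volume `ΛA K t`, a scale `cA K t ≥ 0` with
`cA K t · Ξ(ΛA K t; xA K t) ≤ Σ_s classWeightOfDatum₉ … s` (the gas UNDER-counts run A's total (2.18) weight); and for every step `K`, `|t| ≤ 1`, level `j ∈ [1, jcut K]`, separated
skeleton family `p` and fresh assignment `a`, a finite event `E` of families and a finite set `𝒞` of pins such that every compatible `A ∈ E` inside the volume contains some `C ∈ 𝒞`,
the class weights of the joint-fresh event of `a` are `≤ cA K t ·` (the gas weight of `E`), and `Σ_{C ∈ 𝒞} Π_{γ ∈ C} xA K t γ ≤ Π_b ζ K j i_b` («a history carrying the fresh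
cubes of `a` contains polymers carrying them, of multiplicatively small activity»).  Conclusion: gen 35's `hPA` verbatim — by Peierls' bound in polymer language
(`sum_prod_le_sum_prod_mul_re_polymerPartitionFunction_of_cover`: covered event ≤ (Σ_𝒞 Π x)·Ξ, NO Kotecký–Preiss) and the two comparisons. [bookkeeping] -/
theorem jointFreshSeqLetters_A_of_polymerDom (hζ0 : ∀ K j i, 0 ≤ ζ K j i)
    {PolA : Type*} [DecidableEq PolA] (incA : PolA → PolA → Prop) [DecidableRel incA] [Std.Symm incA]
    (xA : ℕ → ℝ → PolA → ℝ) (ΛA : ℕ → ℝ → Finset PolA) (cA : ℕ → ℝ → ℝ)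
    (hxA : ∀ K t γ, 0 ≤ xA K t γ) (hcA : ∀ K t, 0 ≤ cA K t)
    (htotA : ∀ (K : ℕ) (t : ℝ), |t| ≤ 1 →
      cA K t * (polymerPartitionFunction incA (fun γ => ((xA K t γ : ℝ) : ℂ)) (ΛA K t)).re ≤ ∑ s : SeqOfRecord F θ.ν θ.τ9.M (histA₁₃ θ K₀ g₀ K) (K₀ + K) (K₀ + K), classWeightOfDatum₉ F N θ.toStage9Params (datumOfRecord₁₃CoPH F N θ hP) g₀ os (runA₁₃ F K₀ g₀ K) (histA₁₃ θ K₀ g₀ K) (K₀ + K) t s)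
    (hdomA : ∀ (K : ℕ) (t : ℝ), |t| ≤ 1 → ∀ j ∈ Finset.Icc 1 (jcut K),
      ∀ p ∈ sepAnimalCoverFamily (SiteTouch (P := F.P (K₀ + K)) (j := lv K j)) (SupNear (P := F.P (K₀ + K)) (j := lv K j) (ϱ K j)) (k K j),
      ∀ a ∈ p.2.pi (fun b => (Finset.Icc 1 j).sigma fun i => Finset.univ.filter (fun c : Site (F.P (K₀ + K)) (lv K i) =>
        (↑(iterBlock (lv K i) c) : Set (Site (F.P (K₀ + K)) 0)) ⊆ ↑(iterBlock (lv K j) b))),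
      ∃ E 𝒞 : Finset (Finset PolA), (∀ A ∈ E, A ⊆ ΛA K t → IsCompatible incA A → ∃ C ∈ 𝒞, C ⊆ A) ∧
        ∑ s ∈ Finset.univ.filter (fun s : SeqOfRecord F θ.ν θ.τ9.M (histA₁₃ θ K₀ g₀ K) (K₀ + K) (K₀ + K) =>
          ∀ x ∈ p.2.attach, (↑(iterBlock (lv K (a x.1 x.2).1) (a x.1 x.2).2) : Set (Site (F.P (K₀ + K)) 0)) ⊆ (s.Λ (a x.1 x.2).1)ᶜ ∧
            (2 ≤ (a x.1 x.2).1 → (↑(iterBlock (lv K (a x.1 x.2).1) (a x.1 x.2).2) : Set (Site (F.P (K₀ + K)) 0)) ⊆ s.Λ ((a x.1 x.2).1 - 1))),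
          classWeightOfDatum₉ F N θ.toStage9Params (datumOfRecord₁₃CoPH F N θ hP) g₀ os (runA₁₃ F K₀ g₀ K) (histA₁₃ θ K₀ g₀ K) (K₀ + K) t s ≤
        cA K t * ∑ A ∈ ((ΛA K t).powerset ∩ E) with IsCompatible incA A, ∏ γ ∈ A, xA K t γ ∧
        ∑ C ∈ 𝒞, ∏ γ ∈ C, xA K t γ ≤ ∏ x ∈ p.2.attach, ζ K j (a x.1 x.2).1) :
    ∀ (K : ℕ) (t : ℝ), |t| ≤ 1 → ∀ j ∈ Finset.Icc 1 (jcut K),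
      ∀ p ∈ sepAnimalCoverFamily (SiteTouch (P := F.P (K₀ + K)) (j := lv K j)) (SupNear (P := F.P (K₀ + K)) (j := lv K j) (ϱ K j)) (k K j),
      ∀ a ∈ p.2.pi (fun b => (Finset.Icc 1 j).sigma fun i => Finset.univ.filter (fun c : Site (F.P (K₀ + K)) (lv K i) =>
        (↑(iterBlock (lv K i) c) : Set (Site (F.P (K₀ + K)) 0)) ⊆ ↑(iterBlock (lv K j) b))),
      ∑ s ∈ Finset.univ.filter (fun s : SeqOfRecord F θ.ν θ.τ9.M (histA₁₃ θ K₀ g₀ K) (K₀ + K) (K₀ + K) =>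
          ∀ x ∈ p.2.attach, (↑(iterBlock (lv K (a x.1 x.2).1) (a x.1 x.2).2) : Set (Site (F.P (K₀ + K)) 0)) ⊆ (s.Λ (a x.1 x.2).1)ᶜ ∧
            (2 ≤ (a x.1 x.2).1 → (↑(iterBlock (lv K (a x.1 x.2).1) (a x.1 x.2).2) : Set (Site (F.P (K₀ + K)) 0)) ⊆ s.Λ ((a x.1 x.2).1 - 1))),
        classWeightOfDatum₉ F N θ.toStage9Params (datumOfRecord₁₃CoPH F N θ hP) g₀ os (runA₁₃ F K₀ g₀ K) (histA₁₃ θ K₀ g₀ K) (K₀ + K) t s ≤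
      (∏ x ∈ p.2.attach, ζ K j (a x.1 x.2).1) *
        ∑ s : SeqOfRecord F θ.ν θ.τ9.M (histA₁₃ θ K₀ g₀ K) (K₀ + K) (K₀ + K),
          classWeightOfDatum₉ F N θ.toStage9Params (datumOfRecord₁₃CoPH F N θ hP) g₀ os (runA₁₃ F K₀ g₀ K) (histA₁₃ θ K₀ g₀ K) (K₀ + K) t s := by
  intro K t ht j hj p hp a ha
  obtain ⟨E, 𝒞, hcov, hle, h𝒞⟩ := hdomA K t ht j hj p hp a ha
  have hcover := sum_prod_le_sum_prod_mul_re_polymerPartitionFunction_of_cover (inc := incA) (w := fun γ => ((xA K t γ : ℝ) : ℂ))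
    (fun γ => Complex.ofReal_im _) (fun γ => by simpa only [Complex.ofReal_re] using hxA K t γ) (ΛA K t) E 𝒞 hcov
  simp only [Complex.ofReal_re] at hcover
  have hprod : 0 ≤ ∏ x ∈ p.2.attach, ζ K j (a x.1 x.2).1 := Finset.prod_nonneg fun x _ => hζ0 K j _
  have hZ : 0 ≤ (polymerPartitionFunction incA (fun γ => ((xA K t γ : ℝ) : ℂ)) (ΛA K t)).re :=
    zero_le_one.trans (Literature.Probability.LatticeModels.one_le_re_polymerPartitionFunction (fun γ => Complex.ofReal_im _)
      (fun γ => by simpa only [Complex.ofReal_re] using hxA K t γ) _)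
  calc _ ≤ cA K t * ∑ A ∈ ((ΛA K t).powerset ∩ E) with IsCompatible incA A, ∏ γ ∈ A, xA K t γ := hle
    _ ≤ cA K t * ((∑ C ∈ 𝒞, ∏ γ ∈ C, xA K t γ) * (polymerPartitionFunction incA (fun γ => ((xA K t γ : ℝ) : ℂ)) (ΛA K t)).re) :=
        mul_le_mul_of_nonneg_left hcover (hcA K t)
    _ = (∑ C ∈ 𝒞, ∏ γ ∈ C, xA K t γ) * (cA K t * (polymerPartitionFunction incA (fun γ => ((xA K t γ : ℝ) : ℂ)) (ΛA K t)).re) := by ring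
    _ ≤ (∏ x ∈ p.2.attach, ζ K j (a x.1 x.2).1) * (cA K t * (polymerPartitionFunction incA (fun γ => ((xA K t γ : ℝ) : ℂ)) (ΛA K t)).re) :=
        mul_le_mul_of_nonneg_right h𝒞 (mul_nonneg (hcA K t) hZ)
    _ ≤ _ := mul_le_mul_of_nonneg_left (htotA K t ht) hprod

open scoped Classical in
/-- ★★ **RUN B — THE JOINT-FRESH PRODUCT LETTERS FROM A NON-NEGATIVE HARD-CORE POLYMER DOMINATION** (`0 < M`): the same for run B's sequences `s′` (regions of
`truncShift … s′`) with its own gas `(incB, xB, ΛB, cB)`. [bookkeeping] -/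
theorem jointFreshSeqLetters_B_of_polymerDom (hM : 0 < θ.τ9.M) (hζ0 : ∀ K j i, 0 ≤ ζ K j i)
    {PolB : Type*} [DecidableEq PolB] (incB : PolB → PolB → Prop) [DecidableRel incB] [Std.Symm incB]
    (xB : ℕ → ℝ → PolB → ℝ) (ΛB : ℕ → ℝ → Finset PolB) (cB : ℕ → ℝ → ℝ)
    (hxB : ∀ K t γ, 0 ≤ xB K t γ) (hcB : ∀ K t, 0 ≤ cB K t)
    (htotB : ∀ (K : ℕ) (t : ℝ), |t| ≤ 1 →
      cB K t * (polymerPartitionFunction incB (fun γ => ((xB K t γ : ℝ) : ℂ)) (ΛB K t)).re ≤ ∑ s' : SeqOfRecord F θ.ν θ.τ9.M (histB₁₃ θ K₀ g₀ K) (K₀ + K + 1) (K₀ + K + 1), classWeightOfDatum₉ F N θ.toStage9Params (datumOfRecord₁₃CoPH F N θ hP) g₀ os (runB₁₃ F K₀ g₀ K) (histB₁₃ θ K₀ g₀ K) (K₀ + K + 1) t s')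
    (hdomB : ∀ (K : ℕ) (t : ℝ), |t| ≤ 1 → ∀ j ∈ Finset.Icc 1 (jcut K),
      ∀ p ∈ sepAnimalCoverFamily (SiteTouch (P := F.P (K₀ + K)) (j := lv K j)) (SupNear (P := F.P (K₀ + K)) (j := lv K j) (ϱ K j)) (k K j),
      ∀ a ∈ p.2.pi (fun b => (Finset.Icc 1 j).sigma fun i => Finset.univ.filter (fun c : Site (F.P (K₀ + K)) (lv K i) =>
        (↑(iterBlock (lv K i) c) : Set (Site (F.P (K₀ + K)) 0)) ⊆ ↑(iterBlock (lv K j) b))),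
      ∃ E 𝒞 : Finset (Finset PolB), (∀ A ∈ E, A ⊆ ΛB K t → IsCompatible incB A → ∃ C ∈ 𝒞, C ⊆ A) ∧
        ∑ s' ∈ Finset.univ.filter (fun s' : SeqOfRecord F θ.ν θ.τ9.M (histB₁₃ θ K₀ g₀ K) (K₀ + K + 1) (K₀ + K + 1) =>
          ∀ x ∈ p.2.attach, (↑(iterBlock (lv K (a x.1 x.2).1) (a x.1 x.2).2) : Set (Site (F.P (K₀ + K)) 0)) ⊆
              ((truncShift F θ.ν hM (histB₁₃ θ K₀ g₀ K) s').Λ (a x.1 x.2).1)ᶜ ∧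
            (2 ≤ (a x.1 x.2).1 → (↑(iterBlock (lv K (a x.1 x.2).1) (a x.1 x.2).2) : Set (Site (F.P (K₀ + K)) 0)) ⊆
              (truncShift F θ.ν hM (histB₁₃ θ K₀ g₀ K) s').Λ ((a x.1 x.2).1 - 1))),
          classWeightOfDatum₉ F N θ.toStage9Params (datumOfRecord₁₃CoPH F N θ hP) g₀ os (runB₁₃ F K₀ g₀ K) (histB₁₃ θ K₀ g₀ K) (K₀ + K + 1) t s' ≤
        cB K t * ∑ A ∈ ((ΛB K t).powerset ∩ E) with IsCompatible incB A, ∏ γ ∈ A, xB K t γ ∧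
        ∑ C ∈ 𝒞, ∏ γ ∈ C, xB K t γ ≤ ∏ x ∈ p.2.attach, ζ K j (a x.1 x.2).1) :
    ∀ (K : ℕ) (t : ℝ), |t| ≤ 1 → ∀ j ∈ Finset.Icc 1 (jcut K),
      ∀ p ∈ sepAnimalCoverFamily (SiteTouch (P := F.P (K₀ + K)) (j := lv K j)) (SupNear (P := F.P (K₀ + K)) (j := lv K j) (ϱ K j)) (k K j),
      ∀ a ∈ p.2.pi (fun b => (Finset.Icc 1 j).sigma fun i => Finset.univ.filter (fun c : Site (F.P (K₀ + K)) (lv K i) =>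
        (↑(iterBlock (lv K i) c) : Set (Site (F.P (K₀ + K)) 0)) ⊆ ↑(iterBlock (lv K j) b))),
      ∑ s' ∈ Finset.univ.filter (fun s' : SeqOfRecord F θ.ν θ.τ9.M (histB₁₃ θ K₀ g₀ K) (K₀ + K + 1) (K₀ + K + 1) =>
          ∀ x ∈ p.2.attach, (↑(iterBlock (lv K (a x.1 x.2).1) (a x.1 x.2).2) : Set (Site (F.P (K₀ + K)) 0)) ⊆
              ((truncShift F θ.ν hM (histB₁₃ θ K₀ g₀ K) s').Λ (a x.1 x.2).1)ᶜ ∧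
            (2 ≤ (a x.1 x.2).1 → (↑(iterBlock (lv K (a x.1 x.2).1) (a x.1 x.2).2) : Set (Site (F.P (K₀ + K)) 0)) ⊆
              (truncShift F θ.ν hM (histB₁₃ θ K₀ g₀ K) s').Λ ((a x.1 x.2).1 - 1))),
        classWeightOfDatum₉ F N θ.toStage9Params (datumOfRecord₁₃CoPH F N θ hP) g₀ os (runB₁₃ F K₀ g₀ K) (histB₁₃ θ K₀ g₀ K) (K₀ + K + 1) t s' ≤
      (∏ x ∈ p.2.attach, ζ K j (a x.1 x.2).1) *
        ∑ s' : SeqOfRecord F θ.ν θ.τ9.M (histB₁₃ θ K₀ g₀ K) (K₀ + K + 1) (K₀ + K + 1),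
          classWeightOfDatum₉ F N θ.toStage9Params (datumOfRecord₁₃CoPH F N θ hP) g₀ os (runB₁₃ F K₀ g₀ K) (histB₁₃ θ K₀ g₀ K) (K₀ + K + 1) t s' := by
  intro K t ht j hj p hp a ha
  obtain ⟨E, 𝒞, hcov, hle, h𝒞⟩ := hdomB K t ht j hj p hp a ha
  have hcover := sum_prod_le_sum_prod_mul_re_polymerPartitionFunction_of_cover (inc := incB) (w := fun γ => ((xB K t γ : ℝ) : ℂ))
    (fun γ => Complex.ofReal_im _) (fun γ => by simpa only [Complex.ofReal_re] using hxB K t γ) (ΛB K t) E 𝒞 hcov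
  simp only [Complex.ofReal_re] at hcover
  have hprod : 0 ≤ ∏ x ∈ p.2.attach, ζ K j (a x.1 x.2).1 := Finset.prod_nonneg fun x _ => hζ0 K j _
  have hZ : 0 ≤ (polymerPartitionFunction incB (fun γ => ((xB K t γ : ℝ) : ℂ)) (ΛB K t)).re :=
    zero_le_one.trans (Literature.Probability.LatticeModels.one_le_re_polymerPartitionFunction (fun γ => Complex.ofReal_im _)
      (fun γ => by simpa only [Complex.ofReal_re] using hxB K t γ) _)
  calc _ ≤ cB K t * ∑ A ∈ ((ΛB K t).powerset ∩ E) with IsCompatible incB A, ∏ γ ∈ A, xB K t γ := hle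
    _ ≤ cB K t * ((∑ C ∈ 𝒞, ∏ γ ∈ C, xB K t γ) * (polymerPartitionFunction incB (fun γ => ((xB K t γ : ℝ) : ℂ)) (ΛB K t)).re) :=
        mul_le_mul_of_nonneg_left hcover (hcB K t)
    _ = (∑ C ∈ 𝒞, ∏ γ ∈ C, xB K t γ) * (cB K t * (polymerPartitionFunction incB (fun γ => ((xB K t γ : ℝ) : ℂ)) (ΛB K t)).re) := by ring
    _ ≤ (∏ x ∈ p.2.attach, ζ K j (a x.1 x.2).1) * (cB K t * (polymerPartitionFunction incB (fun γ => ((xB K t γ : ℝ) : ℂ)) (ΛB K t)).re) :=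
        mul_le_mul_of_nonneg_right h𝒞 (mul_nonneg (hcB K t) hZ)
    _ ≤ _ := mul_le_mul_of_nonneg_left (htotB K t ht) hprod

open scoped Classical in
/-- ★★★ **THE N20 FACE FROM NON-NEGATIVE HARD-CORE POLYMER DOMINATIONS OF BOTH RUNS** (gen 35's numerics `hη0 ∕ hη1 ∕ hη₀ ∕ hD ∕ hks ∕ hlv ∕ hlvj ∕ hmono ∕ hζ0 ∕ hζη`
unchanged; its letters `hPA ∕ hPB` DISCHARGED by `jointFreshSeqLetters_A∕B_of_polymerDom`).  For this socket the term-to-total normalisation (R3 of `T4WeightBudgetKP`) is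
thereby reduced to the DOMINATION alone (positivity, no Kotecký–Preiss, no cluster expansion — as `T4PeierlsDomination` §1 found for the UNION-form slot on abstract families): what
remains unprinted is R3b — the history-indexed, positive, multi-step polymer domination of the (2.18) class weights with fresh-cube-multiplicative activities ([LF-II] prints the
per-step signed expansion (1.90)–(1.92) p. 388). [bookkeeping] -/
theorem relWeightBound_card_of_polymerDom_id_supNear (hM : 0 < θ.τ9.M)
    {η : ℕ → ℕ → ℝ} {η₀ : ℝ} (hη0 : ∀ K j, 0 ≤ η K j) (hη1 : ∀ K j, η K j ≤ η₀) (hη₀ : η₀ ≤ 1)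
    (hD : ∀ K j, 2 * ((((2 * ϱ K j + 1) ^ 4 : ℕ) : ℝ) * 3 ^ 4 * ((2 * ϱ K j + 1) ^ 4 : ℕ)) ^ 2 * η K j ≤ 1)
    (hks : ∀ K j, Nat.clog 2 (Fintype.card (Site (F.P (K₀ + K)) (lv K j))) + K + j + 3 ≤ k K j) (hlv : ∀ K j, lv K j ≤ F.m + (K₀ + K))
    (hlvj : ∀ K, ∀ j ∈ Finset.Icc 1 (jcut K), lv K j ≤ j) (hmono : ∀ K i i', 1 ≤ i → i ≤ i' → i' ≤ jcut K → lv K i ≤ lv K i')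
    (hζ0 : ∀ K j i, 0 ≤ ζ K j i)
    (hζη : ∀ K, ∀ j ∈ Finset.Icc 1 (jcut K), ∑ i ∈ Finset.Icc 1 j, ((F.L ^ 4) ^ (lv K j - lv K i) : ℝ) * ζ K j i ≤ η K j)
    {PolA : Type*} [DecidableEq PolA] (incA : PolA → PolA → Prop) [DecidableRel incA] [Std.Symm incA]
    (xA : ℕ → ℝ → PolA → ℝ) (ΛA : ℕ → ℝ → Finset PolA) (cA : ℕ → ℝ → ℝ)
    (hxA : ∀ K t γ, 0 ≤ xA K t γ) (hcA : ∀ K t, 0 ≤ cA K t)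
    (htotA : ∀ (K : ℕ) (t : ℝ), |t| ≤ 1 →
      cA K t * (polymerPartitionFunction incA (fun γ => ((xA K t γ : ℝ) : ℂ)) (ΛA K t)).re ≤ ∑ s : SeqOfRecord F θ.ν θ.τ9.M (histA₁₃ θ K₀ g₀ K) (K₀ + K) (K₀ + K), classWeightOfDatum₉ F N θ.toStage9Params (datumOfRecord₁₃CoPH F N θ hP) g₀ os (runA₁₃ F K₀ g₀ K) (histA₁₃ θ K₀ g₀ K) (K₀ + K) t s)
    (hdomA : ∀ (K : ℕ) (t : ℝ), |t| ≤ 1 → ∀ j ∈ Finset.Icc 1 (jcut K),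
      ∀ p ∈ sepAnimalCoverFamily (SiteTouch (P := F.P (K₀ + K)) (j := lv K j)) (SupNear (P := F.P (K₀ + K)) (j := lv K j) (ϱ K j)) (k K j),
      ∀ a ∈ p.2.pi (fun b => (Finset.Icc 1 j).sigma fun i => Finset.univ.filter (fun c : Site (F.P (K₀ + K)) (lv K i) =>
        (↑(iterBlock (lv K i) c) : Set (Site (F.P (K₀ + K)) 0)) ⊆ ↑(iterBlock (lv K j) b))),
      ∃ E 𝒞 : Finset (Finset PolA), (∀ A ∈ E, A ⊆ ΛA K t → IsCompatible incA A → ∃ C ∈ 𝒞, C ⊆ A) ∧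
        ∑ s ∈ Finset.univ.filter (fun s : SeqOfRecord F θ.ν θ.τ9.M (histA₁₃ θ K₀ g₀ K) (K₀ + K) (K₀ + K) =>
          ∀ x ∈ p.2.attach, (↑(iterBlock (lv K (a x.1 x.2).1) (a x.1 x.2).2) : Set (Site (F.P (K₀ + K)) 0)) ⊆ (s.Λ (a x.1 x.2).1)ᶜ ∧
            (2 ≤ (a x.1 x.2).1 → (↑(iterBlock (lv K (a x.1 x.2).1) (a x.1 x.2).2) : Set (Site (F.P (K₀ + K)) 0)) ⊆ s.Λ ((a x.1 x.2).1 - 1))),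
          classWeightOfDatum₉ F N θ.toStage9Params (datumOfRecord₁₃CoPH F N θ hP) g₀ os (runA₁₃ F K₀ g₀ K) (histA₁₃ θ K₀ g₀ K) (K₀ + K) t s ≤
        cA K t * ∑ A ∈ ((ΛA K t).powerset ∩ E) with IsCompatible incA A, ∏ γ ∈ A, xA K t γ ∧
        ∑ C ∈ 𝒞, ∏ γ ∈ C, xA K t γ ≤ ∏ x ∈ p.2.attach, ζ K j (a x.1 x.2).1)
    {PolB : Type*} [DecidableEq PolB] (incB : PolB → PolB → Prop) [DecidableRel incB] [Std.Symm incB]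
    (xB : ℕ → ℝ → PolB → ℝ) (ΛB : ℕ → ℝ → Finset PolB) (cB : ℕ → ℝ → ℝ)
    (hxB : ∀ K t γ, 0 ≤ xB K t γ) (hcB : ∀ K t, 0 ≤ cB K t)
    (htotB : ∀ (K : ℕ) (t : ℝ), |t| ≤ 1 →
      cB K t * (polymerPartitionFunction incB (fun γ => ((xB K t γ : ℝ) : ℂ)) (ΛB K t)).re ≤ ∑ s' : SeqOfRecord F θ.ν θ.τ9.M (histB₁₃ θ K₀ g₀ K) (K₀ + K + 1) (K₀ + K + 1), classWeightOfDatum₉ F N θ.toStage9Params (datumOfRecord₁₃CoPH F N θ hP) g₀ os (runB₁₃ F K₀ g₀ K) (histB₁₃ θ K₀ g₀ K) (K₀ + K + 1) t s')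
    (hdomB : ∀ (K : ℕ) (t : ℝ), |t| ≤ 1 → ∀ j ∈ Finset.Icc 1 (jcut K),
      ∀ p ∈ sepAnimalCoverFamily (SiteTouch (P := F.P (K₀ + K)) (j := lv K j)) (SupNear (P := F.P (K₀ + K)) (j := lv K j) (ϱ K j)) (k K j),
      ∀ a ∈ p.2.pi (fun b => (Finset.Icc 1 j).sigma fun i => Finset.univ.filter (fun c : Site (F.P (K₀ + K)) (lv K i) =>
        (↑(iterBlock (lv K i) c) : Set (Site (F.P (K₀ + K)) 0)) ⊆ ↑(iterBlock (lv K j) b))),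
      ∃ E 𝒞 : Finset (Finset PolB), (∀ A ∈ E, A ⊆ ΛB K t → IsCompatible incB A → ∃ C ∈ 𝒞, C ⊆ A) ∧
        ∑ s' ∈ Finset.univ.filter (fun s' : SeqOfRecord F θ.ν θ.τ9.M (histB₁₃ θ K₀ g₀ K) (K₀ + K + 1) (K₀ + K + 1) =>
          ∀ x ∈ p.2.attach, (↑(iterBlock (lv K (a x.1 x.2).1) (a x.1 x.2).2) : Set (Site (F.P (K₀ + K)) 0)) ⊆
              ((truncShift F θ.ν hM (histB₁₃ θ K₀ g₀ K) s').Λ (a x.1 x.2).1)ᶜ ∧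
            (2 ≤ (a x.1 x.2).1 → (↑(iterBlock (lv K (a x.1 x.2).1) (a x.1 x.2).2) : Set (Site (F.P (K₀ + K)) 0)) ⊆
              (truncShift F θ.ν hM (histB₁₃ θ K₀ g₀ K) s').Λ ((a x.1 x.2).1 - 1))),
          classWeightOfDatum₉ F N θ.toStage9Params (datumOfRecord₁₃CoPH F N θ hP) g₀ os (runB₁₃ F K₀ g₀ K) (histB₁₃ θ K₀ g₀ K) (K₀ + K + 1) t s' ≤
        cB K t * ∑ A ∈ ((ΛB K t).powerset ∩ E) with IsCompatible incB A, ∏ γ ∈ A, xB K t γ ∧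
        ∑ C ∈ 𝒞, ∏ γ ∈ C, xB K t γ ≤ ∏ x ∈ p.2.attach, ζ K j (a x.1 x.2).1) :
    RelWeightBound 1 (classSetK₁₃ θ K₀ g₀ (keyReadingId₁₃ N K₀ F θ hP g₀ os)) (weightAK₁₃ θ hP K₀ g₀ os (keyReadingId₁₃ N K₀ F θ hP g₀ os))
      (weightBK₁₃ θ hP K₀ g₀ os (keyReadingId₁₃ N K₀ F θ hP g₀ os))
      (badClassK₁₃ θ K₀ g₀ (keyReadingId₁₃ N K₀ F θ hP g₀ os)
        (badKeyReadingOfBigComponent₁₃ N K₀ jcut (bigDialOfCard₁₃ K₀ (fun K j => (2 * ϱ K j + 1) ^ 4 * k K j * (F.L ^ 4) ^ lv K j)) F θ hP g₀ os))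
      (fun K => η₀ * (1 / 2) ^ (K + 1)) :=
  relWeightBound_card_of_jointFreshSeqLetters_id_supNear θ hP K₀ g₀ os jcut ϱ k lv hM hη0 hη1 hη₀ hD hks hlv hlvj hmono hζ0 hζη
    (jointFreshSeqLetters_A_of_polymerDom θ hP K₀ g₀ os jcut ϱ k lv ζ hζ0 incA xA ΛA cA hxA hcA htotA hdomA)
    (jointFreshSeqLetters_B_of_polymerDom θ hP K₀ g₀ os jcut ϱ k lv ζ hM hζ0 incB xB ΛB cB hxB hcB htotB hdomB)

end Polymer

section AgePolymer

variable (θ : Stage13HParams F N) (hP : θ.Provisos₁₃CoPH F N) (K₀ : ℕ) (g₀ : ℕ → ℝ) (os : List (ULoop F)) (jcut : ℕ → ℕ) (ϱ k lv : ℕ → ℕ → ℕ) (q σ τ : ℕ → ℕ → ℝ)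

open scoped Classical in
/-- ★★★ **THE N20 FACE FROM AGE-GEOMETRIC POLYMER DOMINATIONS UNDER ONE PRINT-SHAPED INEQUALITY** (§1 ∘ §2): polymer dominations of both runs whose pins have
activity-sum `≤ Π_b e^{−q K j}·σ K j^{lv K j − lv K i_b}·τ K j^{j − i_b}` (creation × survival factors), the level ∕ schedule hypotheses, `L^4·σ ≤ 1`, `τ ≤ ½` and
`4·((2ϱ+1)^4·81·(2ϱ+1)^4)²·e^{−q K j} ≤ 1` on `[1, jcut K]` give the face with `W K = 2^{−(K+1)}`. [bookkeeping] -/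
theorem relWeightBound_card_of_agePolymerDom_id_supNear (hM : 0 < θ.τ9.M)
    (hσ0 : ∀ K j, 0 ≤ σ K j) (hσ : ∀ K j, ((F.L : ℝ) ^ 4) * σ K j ≤ 1) (hτ0 : ∀ K j, 0 ≤ τ K j) (hτ : ∀ K j, τ K j ≤ 1 / 2)
    (hq : ∀ K, ∀ j ∈ Finset.Icc 1 (jcut K), 2 * ((((2 * ϱ K j + 1) ^ 4 : ℕ) : ℝ) * 3 ^ 4 * ((2 * ϱ K j + 1) ^ 4 : ℕ)) ^ 2 * (2 * Real.exp (-q K j)) ≤ 1)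
    (hks : ∀ K j, Nat.clog 2 (Fintype.card (Site (F.P (K₀ + K)) (lv K j))) + K + j + 3 ≤ k K j) (hlv : ∀ K j, lv K j ≤ F.m + (K₀ + K))
    (hlvj : ∀ K, ∀ j ∈ Finset.Icc 1 (jcut K), lv K j ≤ j) (hmono : ∀ K i i', 1 ≤ i → i ≤ i' → i' ≤ jcut K → lv K i ≤ lv K i')
    {PolA : Type*} [DecidableEq PolA] (incA : PolA → PolA → Prop) [DecidableRel incA] [Std.Symm incA]
    (xA : ℕ → ℝ → PolA → ℝ) (ΛA : ℕ → ℝ → Finset PolA) (cA : ℕ → ℝ → ℝ)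
    (hxA : ∀ K t γ, 0 ≤ xA K t γ) (hcA : ∀ K t, 0 ≤ cA K t)
    (htotA : ∀ (K : ℕ) (t : ℝ), |t| ≤ 1 →
      cA K t * (polymerPartitionFunction incA (fun γ => ((xA K t γ : ℝ) : ℂ)) (ΛA K t)).re ≤ ∑ s : SeqOfRecord F θ.ν θ.τ9.M (histA₁₃ θ K₀ g₀ K) (K₀ + K) (K₀ + K), classWeightOfDatum₉ F N θ.toStage9Params (datumOfRecord₁₃CoPH F N θ hP) g₀ os (runA₁₃ F K₀ g₀ K) (histA₁₃ θ K₀ g₀ K) (K₀ + K) t s)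
    (hdomA : ∀ (K : ℕ) (t : ℝ), |t| ≤ 1 → ∀ j ∈ Finset.Icc 1 (jcut K),
      ∀ p ∈ sepAnimalCoverFamily (SiteTouch (P := F.P (K₀ + K)) (j := lv K j)) (SupNear (P := F.P (K₀ + K)) (j := lv K j) (ϱ K j)) (k K j),
      ∀ a ∈ p.2.pi (fun b => (Finset.Icc 1 j).sigma fun i => Finset.univ.filter (fun c : Site (F.P (K₀ + K)) (lv K i) =>
        (↑(iterBlock (lv K i) c) : Set (Site (F.P (K₀ + K)) 0)) ⊆ ↑(iterBlock (lv K j) b))),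
      ∃ E 𝒞 : Finset (Finset PolA), (∀ A ∈ E, A ⊆ ΛA K t → IsCompatible incA A → ∃ C ∈ 𝒞, C ⊆ A) ∧
        ∑ s ∈ Finset.univ.filter (fun s : SeqOfRecord F θ.ν θ.τ9.M (histA₁₃ θ K₀ g₀ K) (K₀ + K) (K₀ + K) =>
          ∀ x ∈ p.2.attach, (↑(iterBlock (lv K (a x.1 x.2).1) (a x.1 x.2).2) : Set (Site (F.P (K₀ + K)) 0)) ⊆ (s.Λ (a x.1 x.2).1)ᶜ ∧
            (2 ≤ (a x.1 x.2).1 → (↑(iterBlock (lv K (a x.1 x.2).1) (a x.1 x.2).2) : Set (Site (F.P (K₀ + K)) 0)) ⊆ s.Λ ((a x.1 x.2).1 - 1))),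
          classWeightOfDatum₉ F N θ.toStage9Params (datumOfRecord₁₃CoPH F N θ hP) g₀ os (runA₁₃ F K₀ g₀ K) (histA₁₃ θ K₀ g₀ K) (K₀ + K) t s ≤
        cA K t * ∑ A ∈ ((ΛA K t).powerset ∩ E) with IsCompatible incA A, ∏ γ ∈ A, xA K t γ ∧
        ∑ C ∈ 𝒞, ∏ γ ∈ C, xA K t γ ≤ ∏ x ∈ p.2.attach, (Real.exp (-q K j) * σ K j ^ (lv K j - lv K (a x.1 x.2).1) * τ K j ^ (j - (a x.1 x.2).1)))
    {PolB : Type*} [DecidableEq PolB] (incB : PolB → PolB → Prop) [DecidableRel incB] [Std.Symm incB]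
    (xB : ℕ → ℝ → PolB → ℝ) (ΛB : ℕ → ℝ → Finset PolB) (cB : ℕ → ℝ → ℝ)
    (hxB : ∀ K t γ, 0 ≤ xB K t γ) (hcB : ∀ K t, 0 ≤ cB K t)
    (htotB : ∀ (K : ℕ) (t : ℝ), |t| ≤ 1 →
      cB K t * (polymerPartitionFunction incB (fun γ => ((xB K t γ : ℝ) : ℂ)) (ΛB K t)).re ≤ ∑ s' : SeqOfRecord F θ.ν θ.τ9.M (histB₁₃ θ K₀ g₀ K) (K₀ + K + 1) (K₀ + K + 1), classWeightOfDatum₉ F N θ.toStage9Params (datumOfRecord₁₃CoPH F N θ hP) g₀ os (runB₁₃ F K₀ g₀ K) (histB₁₃ θ K₀ g₀ K) (K₀ + K + 1) t s')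
    (hdomB : ∀ (K : ℕ) (t : ℝ), |t| ≤ 1 → ∀ j ∈ Finset.Icc 1 (jcut K),
      ∀ p ∈ sepAnimalCoverFamily (SiteTouch (P := F.P (K₀ + K)) (j := lv K j)) (SupNear (P := F.P (K₀ + K)) (j := lv K j) (ϱ K j)) (k K j),
      ∀ a ∈ p.2.pi (fun b => (Finset.Icc 1 j).sigma fun i => Finset.univ.filter (fun c : Site (F.P (K₀ + K)) (lv K i) =>
        (↑(iterBlock (lv K i) c) : Set (Site (F.P (K₀ + K)) 0)) ⊆ ↑(iterBlock (lv K j) b))),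
      ∃ E 𝒞 : Finset (Finset PolB), (∀ A ∈ E, A ⊆ ΛB K t → IsCompatible incB A → ∃ C ∈ 𝒞, C ⊆ A) ∧
        ∑ s' ∈ Finset.univ.filter (fun s' : SeqOfRecord F θ.ν θ.τ9.M (histB₁₃ θ K₀ g₀ K) (K₀ + K + 1) (K₀ + K + 1) =>
          ∀ x ∈ p.2.attach, (↑(iterBlock (lv K (a x.1 x.2).1) (a x.1 x.2).2) : Set (Site (F.P (K₀ + K)) 0)) ⊆
              ((truncShift F θ.ν hM (histB₁₃ θ K₀ g₀ K) s').Λ (a x.1 x.2).1)ᶜ ∧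
            (2 ≤ (a x.1 x.2).1 → (↑(iterBlock (lv K (a x.1 x.2).1) (a x.1 x.2).2) : Set (Site (F.P (K₀ + K)) 0)) ⊆
              (truncShift F θ.ν hM (histB₁₃ θ K₀ g₀ K) s').Λ ((a x.1 x.2).1 - 1))),
          classWeightOfDatum₉ F N θ.toStage9Params (datumOfRecord₁₃CoPH F N θ hP) g₀ os (runB₁₃ F K₀ g₀ K) (histB₁₃ θ K₀ g₀ K) (K₀ + K + 1) t s' ≤
        cB K t * ∑ A ∈ ((ΛB K t).powerset ∩ E) with IsCompatible incB A, ∏ γ ∈ A, xB K t γ ∧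
        ∑ C ∈ 𝒞, ∏ γ ∈ C, xB K t γ ≤ ∏ x ∈ p.2.attach, (Real.exp (-q K j) * σ K j ^ (lv K j - lv K (a x.1 x.2).1) * τ K j ^ (j - (a x.1 x.2).1))) :
    RelWeightBound 1 (classSetK₁₃ θ K₀ g₀ (keyReadingId₁₃ N K₀ F θ hP g₀ os)) (weightAK₁₃ θ hP K₀ g₀ os (keyReadingId₁₃ N K₀ F θ hP g₀ os))
      (weightBK₁₃ θ hP K₀ g₀ os (keyReadingId₁₃ N K₀ F θ hP g₀ os))
      (badClassK₁₃ θ K₀ g₀ (keyReadingId₁₃ N K₀ F θ hP g₀ os)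
        (badKeyReadingOfBigComponent₁₃ N K₀ jcut (bigDialOfCard₁₃ K₀ (fun K j => (2 * ϱ K j + 1) ^ 4 * k K j * (F.L ^ 4) ^ lv K j)) F θ hP g₀ os))
      (fun K => (1 : ℝ) * (1 / 2) ^ (K + 1)) :=
  relWeightBound_card_of_ageJointFreshSeqLetters_id_supNear θ hP K₀ g₀ os jcut ϱ k lv q σ τ hM hσ0 hσ hτ0 hτ hq hks hlv hlvj hmono
    (jointFreshSeqLetters_A_of_polymerDom θ hP K₀ g₀ os jcut ϱ k lv (fun K j i => Real.exp (-q K j) * σ K j ^ (lv K j - lv K i) * τ K j ^ (j - i))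
      (fun K j _ => mul_nonneg (mul_nonneg (Real.exp_pos _).le (pow_nonneg (hσ0 K j) _)) (pow_nonneg (hτ0 K j) _)) incA xA ΛA cA hxA hcA htotA hdomA)
    (jointFreshSeqLetters_B_of_polymerDom θ hP K₀ g₀ os jcut ϱ k lv (fun K j i => Real.exp (-q K j) * σ K j ^ (lv K j - lv K i) * τ K j ^ (j - i)) hM
      (fun K j _ => mul_nonneg (mul_nonneg (Real.exp_pos _).le (pow_nonneg (hσ0 K j) _)) (pow_nonneg (hτ0 K j) _)) incB xB ΛB cB hxB hcB htotB hdomB)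

end AgePolymer

end YMDAG.UVSplit

end
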